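import Mathlib
import Summits.AnomalousDissipation.AnomalousDissipation.Theorems.SoloBlindPolarGaussian

/-!
# SEIL-F outer end: closed form of the frozen polar closure and the reservoir law (solo-blind s87, kernel #196)

Kernel #195 (`SoloBlindPolarGaussian`) showed that `S = (B + C θ²) e^{-a θ²}` solves the polar
inner equation `∂_t S = K₀ ∂²_θ S - i κ θ² S` iff
`a' = iκ - 4K₀ a²`, `C' = -10 K₀ a C`, `B' = -2 K₀ a B + 2 K₀ C`.
For FROZEN `κ` (the adiabatic leading order; `ω = (2 K₀ P |h|)^{1/2}` is fast against the
carrier period) this system is solvable in closed form.  With `A⋆` any root of `4 K₀ A⋆² = i κ`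
(e.g. `polarFixedPoint`) and the complex phase `ζ(e) = 4 K₀ A⋆ e` of the elapsed time `e`:

* `a(e) = A⋆ tanh ζ(e)`  (Riccati, data `a(0) = 0`),
* `C(e) = C₀ q(e)⁵`, `B(e) = (B₀ + (C₀ / 2A⋆) tanh ζ(e)) · q(e)`  for ANY `q` with
  `q' = -2 K₀ a q` and `q⁴ cosh² ζ = 1` (i.e. `q = cosh^{-1/2} ζ`, stated without complex powers).

Consequences used by LEMMA R (PLAN §109 (c)): the `θ²`-moment decays like `cosh^{-5/2}`, the cap
amplitude like `cosh^{-1/2}` (rate `Re 2K₀A⋆ = (K₀κ/2)^{1/2}`, kernel #195), and pure curvature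
data `(B₀, C₀) = (0, C₀)` GENERATES the cap amplitude `(C₀ / 2A⋆)·tanh ζ · q` — the polar
"reservoir" of D74: with `C₀ = -(hₓ/h)` (the frame's polar curvature) its size is
`|C₀| (K₀/κ)^{1/2} ∝ P^{-1/2}` since `|2A⋆|² = κ/K₀` (`polarFixedPoint_normSq_two_mul`).

Everything here is exact algebra/calculus over `ℂ` along a real time variable; no analysis of
the PDE remainder is claimed.
-/

namespace Summit.AnomalousDissipation.AnomalousDissipation.Theorems

open Complex

/-- The complex "tanh" written as `sinh / cosh` (Mathlib's `Complex.tanh` is this by definition;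
we keep the quotient explicit to control the non-vanishing hypothesis). -/
noncomputable def polarTh (c : ℂ) (e : ℝ) : ℂ := Complex.sinh (c * e) / Complex.cosh (c * e)

/-- `e ↦ sinh (c e)` has derivative `c cosh (c e)` along the real variable `e`. -/
theorem hasDerivAt_sinh_mul_ofReal (c : ℂ) (e : ℝ) :
    HasDerivAt (fun x : ℝ => Complex.sinh (c * x)) (c * Complex.cosh (c * e)) e := by
  have h1 : HasDerivAt (fun z : ℂ => c * z) c (e : ℂ) := by
    simpa using (hasDerivAt_id (e : ℂ)).const_mul c
  have h2 : HasDerivAt (fun z : ℂ => Complex.sinh (c * z)) (Complex.cosh (c * e) * c) (e : ℂ) :=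
    (Complex.hasDerivAt_sinh (c * e)).comp (e : ℂ) h1
  have h3 := h2.comp_ofReal
  simpa [mul_comm] using h3

/-- `e ↦ cosh (c e)` has derivative `c sinh (c e)` along the real variable `e`. -/
theorem hasDerivAt_cosh_mul_ofReal (c : ℂ) (e : ℝ) :
    HasDerivAt (fun x : ℝ => Complex.cosh (c * x)) (c * Complex.sinh (c * e)) e := by
  have h1 : HasDerivAt (fun z : ℂ => c * z) c (e : ℂ) := by
    simpa using (hasDerivAt_id (e : ℂ)).const_mul c
  have h2 : HasDerivAt (fun z : ℂ => Complex.cosh (c * z)) (Complex.sinh (c * e) * c) (e : ℂ) :=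
    (Complex.hasDerivAt_cosh (c * e)).comp (e : ℂ) h1
  have h3 := h2.comp_ofReal
  simpa [mul_comm] using h3

/-- Derivative of `tanh (c e) = sinh/cosh`: `c / cosh² (c e)` (where `cosh (c e) ≠ 0`). -/
theorem hasDerivAt_polarTh (c : ℂ) (e : ℝ) (hc : Complex.cosh (c * e) ≠ 0) :
    HasDerivAt (polarTh c) (c / Complex.cosh (c * e) ^ 2) e := by
  have hs := hasDerivAt_sinh_mul_ofReal c e
  have hco := hasDerivAt_cosh_mul_ofReal c e
  have h := hs.div hco hc
  have key : (c * Complex.cosh (c * e) * Complex.cosh (c * e)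
        - Complex.sinh (c * e) * (c * Complex.sinh (c * e))) = c := by
    have h1 := Complex.cosh_sq_sub_sinh_sq (c * e)
    linear_combination c * h1
  have h2 : HasDerivAt (fun x : ℝ => Complex.sinh (c * x) / Complex.cosh (c * x))
      ((c * Complex.cosh (c * e) * Complex.cosh (c * e)
        - Complex.sinh (c * e) * (c * Complex.sinh (c * e))) / Complex.cosh (c * e) ^ 2) e := h
  rw [key] at h2
  exact h2

/-- (i) The Riccati equation in closed form: if `4 K₀ A⋆² = i κ` then `a(e) = A⋆ tanh(4K₀A⋆ e)`
solves `a' = i κ - 4 K₀ a²` (wherever `cosh ≠ 0`). -/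
theorem polarRiccati_tanh (K₀ κ A : ℂ) (hA : 4 * K₀ * A ^ 2 = I * κ) (e : ℝ)
    (hc : Complex.cosh (4 * K₀ * A * e) ≠ 0) :
    HasDerivAt (fun x : ℝ => A * polarTh (4 * K₀ * A) x)
      (I * κ - 4 * K₀ * (A * polarTh (4 * K₀ * A) e) ^ 2) e := by
  have h := (hasDerivAt_polarTh (4 * K₀ * A) e hc).const_mul A
  refine h.congr_deriv ?_
  have h1 := Complex.cosh_sq_sub_sinh_sq (4 * K₀ * A * e)
  unfold polarTh
  generalize Complex.cosh (4 * K₀ * A * e) = Co at *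
  generalize Complex.sinh (4 * K₀ * A * e) = Si at *
  have hS : Si ^ 2 = Co ^ 2 - 1 := by linear_combination -h1
  rw [← hA, mul_pow, div_pow, hS]
  field_simp
  ring

/-- (ii) The moment equations in closed form.  Let `a = A⋆ tanh ζ` as in (i), let `q` satisfy
`q' = -2 K₀ a q` at `e` and the branch-free identity `q(e)⁴ cosh² ζ(e) = 1` (so `q = cosh^{-1/2} ζ`),
and put `C = C₀ q⁵`, `B = (B₀ + (C₀/(2A⋆)) tanh ζ) q`.  Then `C' = -10 K₀ a C` and
`B' = -2 K₀ a B + 2 K₀ C` at `e`. -/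
theorem polarClosure_closedForm (K₀ A B₀ C₀ : ℂ) (hA0 : A ≠ 0) {q : ℝ → ℂ} {e : ℝ}
    (hc : Complex.cosh (4 * K₀ * A * e) ≠ 0)
    (hq : HasDerivAt q (-2 * K₀ * (A * polarTh (4 * K₀ * A) e) * q e) e)
    (hq4 : q e ^ 4 * Complex.cosh (4 * K₀ * A * e) ^ 2 = 1) :
    HasDerivAt (fun x : ℝ => C₀ * q x ^ 5)
        (-10 * K₀ * (A * polarTh (4 * K₀ * A) e) * (C₀ * q e ^ 5)) e ∧
    HasDerivAt (fun x : ℝ => (B₀ + C₀ / (2 * A) * polarTh (4 * K₀ * A) x) * q x)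
        (-2 * K₀ * (A * polarTh (4 * K₀ * A) e)
            * ((B₀ + C₀ / (2 * A) * polarTh (4 * K₀ * A) e) * q e)
          + 2 * K₀ * (C₀ * q e ^ 5)) e := by
  constructor
  · have h := (hq.pow 5).const_mul C₀
    refine h.congr_deriv ?_
    push_cast
    ring
  · have hth := hasDerivAt_polarTh (4 * K₀ * A) e hc
    have h1 : HasDerivAt (fun x : ℝ => B₀ + C₀ / (2 * A) * polarTh (4 * K₀ * A) x)
        (C₀ / (2 * A) * ((4 * K₀ * A) / Complex.cosh (4 * K₀ * A * e) ^ 2)) e := by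
      simpa using (hth.const_mul (C₀ / (2 * A))).const_add B₀
    have h := h1.mul hq
    refine h.congr_deriv ?_
    generalize hCo : Complex.cosh (4 * K₀ * A * e) = Co at *
    generalize polarTh (4 * K₀ * A) e = Th at *
    have hCo2 : Co ^ 2 ≠ 0 := pow_ne_zero 2 hc
    -- use q⁴ cosh² = 1 in the form q⁵ = q / cosh²
    have hq5 : q e ^ 5 = q e / Co ^ 2 := by
      rw [eq_div_iff hCo2]
      linear_combination (q e) * hq4
    rw [hq5]
    field_simp
    ring

/-- (iii) The reservoir law, algebraic form: the closed-form `B` splits as the decaying datum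
`B₀ q` plus the GENERATED cap amplitude `(C₀/(2A⋆)) tanh ζ · q`. -/
theorem polarReservoir_split (A B₀ C₀ : ℂ) (q th : ℂ) :
    (B₀ + C₀ / (2 * A) * th) * q = B₀ * q + (C₀ / (2 * A)) * th * q := by ring

/-- `|2 a⋆|² = κ / K₀` for the fixed point of kernel #195 (`κ ≥ 0`, `K₀ > 0`): hence the
generated cap amplitude from curvature `C₀` has modulus `|C₀| (K₀/κ)^{1/2} |tanh ζ| |q|`,
i.e. `∝ P^{-1/2}` for `κ = P |h|`. -/
theorem polarFixedPoint_normSq_two_mul (K₀ κ : ℝ) (hK : 0 < K₀) (hκ : 0 ≤ κ) :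
    Complex.normSq (2 * polarFixedPoint K₀ κ) = κ / K₀ := by
  unfold polarFixedPoint
  have hs : Real.sqrt (κ / (8 * K₀)) * Real.sqrt (κ / (8 * K₀)) = κ / (8 * K₀) :=
    Real.mul_self_sqrt (div_nonneg hκ (by positivity))
  rw [Complex.normSq_mul, Complex.normSq_mul, Complex.normSq_ofReal, hs]
  have h2 : Complex.normSq 2 = 4 := by norm_num [Complex.normSq_apply]
  have h3 : Complex.normSq (1 + I) = 2 := by simp [Complex.normSq_apply]; norm_num
  rw [h2, h3]
  have hK0 : K₀ ≠ 0 := ne_of_gt hK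
  field_simp
  ring

/-- The fixed point of kernel #195 is an admissible `A⋆` for (i)–(ii): `4 K₀ a⋆² = i κ`. -/
theorem polarFixedPoint_four_mul_sq (K₀ κ : ℝ) (hK : 0 < K₀) (hκ : 0 ≤ κ) :
    4 * (K₀ : ℂ) * polarFixedPoint K₀ κ ^ 2 = I * κ := by
  rw [polarFixedPoint_sq K₀ κ hK hκ]
  have hK0 : (K₀ : ℂ) ≠ 0 := by exact_mod_cast (ne_of_gt hK)
  push_cast
  field_simp

end Summit.AnomalousDissipation.AnomalousDissipation.Theorems
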